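/-
Copyright (c) 2026 the pub-hodgecm-mathlib formalisation cell (harness21).  Prover seat hodgecm-mathlib-K2Liu-p13 (g2), Track B «K2-LIT»,
#184♮ = hLiu418 = `stmt-HodgeConjecture-24832`; Road I v3 organ U1-CT-ind STAGE 2 (Q2), file F5-p (E1's `hf` for the inner section of term 2 — assembly of ★ F5-c∕n∕o).
-/
import Summits.HodgeConjecture.HodgeConjecture.Theorems.K2LiuKlingenInnerSectionModulus       -- ★ F5-n: `klingenInner_hscale`, `fst∕snd_klingenSubst` (+ ★ F5-c the law, ★ F5-i)
import Summits.HodgeConjecture.HodgeConjecture.Theorems.K2LiuAdelicScalarModulus             -- ★∕📤 F5-o: `map_mul_right_eq_self_of_principal`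
import Summits.HodgeConjecture.HodgeConjecture.Theorems.K2LiuKlingenCellOneEisensteinU        -- ★ F5-f: `jAdelic_klingenLevi_one_symm_toAdelic`, `coe_jAdelic_two_symm_toAdelic`
import Summits.HodgeConjecture.HodgeConjecture.Theorems.K2LiuSiegelCharacterTrivialOnRational  -- ★ #10a `siegelDeltaCharacter_eq_one_of_mem_ratH`
import HarnessLib

/-!
# Crux `HLiu418`, Road I v3, organ U1 stage 2 (Q2), file F5-p: THE INNER SECTION OF TERM 2 IS LEFT-`B₂(L⁺)`-INVARIANT —
# `F(Ψ(toAdelic m_Q(1,b)) · x) = F(x)` for rational upper-triangular `b`, `F(x) = ∫ f(Ψ(ξ)·Ψ(n_Q(y,0,t))·x) d(μ_Y × μ_T)` (E1's `hf` for term 2)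

Cell `hodgecm-mathlib`, crux item hLiu418 = `stmt-HodgeConjecture-24832`; squad K2 ∕ K2Liu; LEAD F0P6-plan (g14), co-dealer K2E5-plan (g7); prover K2Liu-p13 (g2).
THEOREMS ONLY (no `def`, no instance, no notation, no named-fact hypothesis, no `sorry`); lane `--supports stmt-HodgeConjecture-24832 --as helper` (count-neutral).
ASSEMBLY of ★ F5-c `klingenInner_levi_law` (the law, `a = 1`) with ★ F5-n `klingenInner_hscale` (the substitution on `P = Y × 𝔸_L`, `δ = D_Y D_T`), ★∕📤 F5-o (`D_T = 1` for the
principal idele `b₀₀ = ι(b₀₀^L)`, product formula; `D_Y = 1` at `a = 1` trivially) and ★ #10a (the inducing character is `1` on `H(L⁺)`: `Ψ(ξ m_Q(1,b) ξ⁻¹)` is rational):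
* `toAdelic_weylXi_eq_jAdelic` (rational versus adelic `ξ`), `transport_conj_klingenLevi_mem_ratH`, `map_scaleY_one_eq`, `map_scaleT_principal_eq`;
* **`klingenInner_borelU_mul`**: for `b ∈ borelU c J₂` (E1's rational Borel of `U(J₂)(L⁺)`) and every `x ∈ H(𝔸)`,
  `F(Ψ(toAdelic₄ m_Q^L(1, b)) · x) = F(x)` — with ★ F5-e (`∫ β₁ • f(Ψξ u ·) dνN = C · F`) this is E1's hypothesis `hf` for the section of ★ F5-g's `eisensteinSeriesU F_h`,
  hence (★ E1 `eisensteinSeriesU_rational_mul`) the AUTOMORPHY of term 2 of `E_Q` on the Klingen Levi.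
[MoeglinWaldspurger1995, II.1.5, II.1.7], [WeilBNT1967, Ch. IV §4 Thm. 5], [Liu2021, §B.3 p. 101], [Garrett2018, §3.10].
HONEST LABEL.  Count-neutral helper: `HC_CM` is proved only modulo the 7 printed citations (2 remaining named inputs: hLiu418 = `stmt-HodgeConjecture-24832`,
h413 = `stmt-HodgeConjecture-24833`) until rung 0 closes.
-/

set_option autoImplicit false
set_option linter.dupNamespace false -- the mandated namespace repeats `HodgeConjecture.HodgeConjecture`

noncomputable section

open scoped Matrix ENNReal NNReal
open NumberField IsDedekindDomain MeasureTheory MeasureTheory.Measure Function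

namespace Summit.HodgeConjecture.HodgeConjecture.Cruxes.HLiu418.K2LiuKlingenInnerSectionBorelInvariant

open Literature.NumberTheory.Automorphic Literature.NumberTheory.Automorphic.UnitaryGroup
open Literature.NumberTheory.GelbartRogawski1991 Literature.NumberTheory.GelbartRogawski1991.GRConstruction
open Literature.NumberTheory.GaloisRepresentations
open Literature.NumberTheory.K2Lit.SiegelDoubled
open Summit.HodgeConjecture.HodgeConjecture.Cruxes.HLiu418.K2LiuDoubledUTwoTwoBorelFrame
open Summit.HodgeConjecture.HodgeConjecture.Cruxes.HLiu418.K2LiuKlingenParabolicDefs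
open Summit.HodgeConjecture.HodgeConjecture.Cruxes.HLiu418.K2LiuKlingenUnipotentDefs
open Summit.HodgeConjecture.HodgeConjecture.Cruxes.HLiu418.K2LiuKlingenUnipotentAdelicDefs
open Summit.HodgeConjecture.HodgeConjecture.Cruxes.HLiu418.K2LiuKlingenRationalCells (coe_adelicVal_toAdelic complexConj_ringHom_apply_apply transport_toAdelic_mem_ratH)
open Summit.HodgeConjecture.HodgeConjecture.Cruxes.HLiu418.K2LiuKlingenInnerSectionLeviLaw (upper_rel₂ klingenInner_levi_law)
open Summit.HodgeConjecture.HodgeConjecture.Cruxes.HLiu418.K2LiuKlingenInnerSectionModulus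
open Summit.HodgeConjecture.HodgeConjecture.Cruxes.HLiu418.K2LiuAdelicScalarModulus (map_mul_right_eq_self_of_principal units_map_algebraMap_mem_principalIdeles)
open Summit.HodgeConjecture.HodgeConjecture.Cruxes.HLiu418.K2LiuKlingenCellOneEisensteinU (coe_jAdelic_two_symm_toAdelic jAdelic_klingenLevi_one_symm_toAdelic)
open Summit.HodgeConjecture.HodgeConjecture.Cruxes.HLiu418.K2LiuSiegelCharacterTrivialOnRational (siegelDeltaCharacter_eq_one_of_mem_ratH)
open Summit.HodgeConjecture.HodgeConjecture.Cruxes.HLiu418.K2LiuSiegelDoubledLeviMatrix (conjAdele_conjAdele')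
open Summit.HodgeConjecture.HodgeConjecture.Cruxes.H413.K2E1BruhatCosetsU (mem_borelU_iff_apply_eq_zero_two)
open UnitaryDualPair

variable {L : Type} [Field L] [NumberField L] [IsCMField L]
variable {N M : ℕ} {e : Fin N × Fin M ≃ Fin 2}
  {dV : Fin N → L} {hdV : ∀ i, IsCMField.complexConj L (dV i) = dV i}
  {dW : Fin M → L} {hdW : ∀ i, IsCMField.complexConj L (dW i) = dW i}

section Transport

variable {SA : GL (Fin (2 + 2)) (AdeleRing (𝓞 L) L)}
  {Ψ : (quasiSplit (Fp L) L (IsCMField.complexConj L) (2 + 2)).Adelic ≃ₜ* HA L e dV hdV dW hdW} {X Y : Matrix (Fin 2) (Fin 2) (Fp L)} {a : Fp L}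
  (hΨ : ∀ g : (quasiSplit (Fp L) L (IsCMField.complexConj L) (2 + 2)).Adelic,
    (((Ψ g : HA L e dV hdV dW hdW) : GL (Fin (2 + 2)) (AdeleRing (𝓞 L) L)) : Matrix (Fin (2 + 2)) (Fin (2 + 2)) (AdeleRing (𝓞 L) L)) =
      (SA : Matrix (Fin (2 + 2)) (Fin (2 + 2)) (AdeleRing (𝓞 L) L)) *
        ((adelicVal (Fp L) L (IsCMField.complexConj L) (2 + 2) _ g : GL (Fin (2 + 2)) (AdeleRing (𝓞 L) L)) :
          Matrix (Fin (2 + 2)) (Fin (2 + 2)) (AdeleRing (𝓞 L) L)) *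
        ((SA⁻¹ : GL (Fin (2 + 2)) (AdeleRing (𝓞 L) L)) : Matrix (Fin (2 + 2)) (Fin (2 + 2)) (AdeleRing (𝓞 L) L)))
  (ha : a + a = 1)
  (hSA : Matrix.reindex (e₂ (n := 2)).symm (e₂ (n := 2)).symm (SA : Matrix (Fin (2 + 2)) (Fin (2 + 2)) (AdeleRing (𝓞 L) L)) =
    Matrix.fromBlocks (1 : Matrix (Fin 2) (Fin 2) (AdeleRing (𝓞 L) L)) (X.map ((algebraMap L (AdeleRing (𝓞 L) L)).comp (algebraMap (Fp L) L))) 1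
      (-(X.map ((algebraMap L (AdeleRing (𝓞 L) L)).comp (algebraMap (Fp L) L)))))
  (hSAi : Matrix.reindex (e₂ (n := 2)).symm (e₂ (n := 2)).symm ((SA⁻¹ : GL (Fin (2 + 2)) (AdeleRing (𝓞 L) L)) : Matrix (Fin (2 + 2)) (Fin (2 + 2)) (AdeleRing (𝓞 L) L)) =
    Matrix.fromBlocks ((a • (1 : Matrix (Fin 2) (Fin 2) (Fp L))).map ((algebraMap L (AdeleRing (𝓞 L) L)).comp (algebraMap (Fp L) L)))
      ((a • (1 : Matrix (Fin 2) (Fin 2) (Fp L))).map ((algebraMap L (AdeleRing (𝓞 L) L)).comp (algebraMap (Fp L) L)))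
      (Y.map ((algebraMap L (AdeleRing (𝓞 L) L)).comp (algebraMap (Fp L) L)))
      (-(Y.map ((algebraMap L (AdeleRing (𝓞 L) L)).comp (algebraMap (Fp L) L)))))
  (hXY : X * Y = a • (1 : Matrix (Fin 2) (Fin 2) (Fp L))) (hYX : Y * X = a • (1 : Matrix (Fin 2) (Fin 2) (Fp L)))
  (hΨP : ∀ b : (quasiSplit (Fp L) L (IsCMField.complexConj L) (2 + 2)).Adelic,
    ((adelicVal (Fp L) L (IsCMField.complexConj L) (2 + 2) _ b : GL (Fin (2 + 2)) (AdeleRing (𝓞 L) L)) :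
        Matrix (Fin (2 + 2)) (Fin (2 + 2)) (AdeleRing (𝓞 L) L)).BlockTriangular id →
      IsSiegelDelta L e dV hdV dW hdW (Ψ b))

/-! ## §1 Letters -/

omit [IsCMField L] in
/-- **rational versus adelic `ξ`**: `toAdelic₄ ξ^L = jAdelic ξ^𝔸` (the `0∕1` matrix `weylXiM` is its own image under `ι`). [cite: Xiong2013, §7 Lemma 7.1] [cite: Mok2014, §1 Notation p. 5] -/
theorem toAdelic_weylXi_eq_jAdelic [IsCMField L] :
    UnitaryGroup.toAdelic (Fp L) L (IsCMField.complexConj L) (2 + 2) ((StdForm.antidiagonal (2 + 2)).over L) (weylXi L ((IsCMField.complexConj L : L ≃ₐ[Fp L] L) : L →+* L)) = jAdelic L 4 (weylXi (AdeleRing (𝓞 L) L) (conjAdele (Fp L) L (IsCMField.complexConj L))) := by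
  refine adelicVal_injective (Fp L) L (IsCMField.complexConj L) (2 + 2) _ (Units.ext ?_)
  rw [coe_adelicVal_toAdelic L (2 + 2), coe_weylXi, coe_adelicVal_jAdelic, coe_weylXi]
  ext i j
  fin_cases i <;> fin_cases j <;> simp [weylXiM]

include hΨ ha hSA hSAi hXY hYX in
/-- **`Ψ(ξ^𝔸 · m_Q^𝔸(1, j₂⁻¹(toAdelic b)) · (ξ^𝔸)⁻¹) ∈ H(L⁺)`** (it is `Ψ(toAdelic₄ (ξ m_Q^L(1,b) ξ⁻¹))`). [cite: Xiong2013, §4 Prop. 4.1] -/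
theorem transport_conj_klingenLevi_mem_ratH (bL : unitaryGroupOfForm ((IsCMField.complexConj L : L ≃ₐ[Fp L] L) : L →+* L) ((StdForm.antidiagonal 2).over L)) :
    Ψ (jAdelic L 4 ((weylXi (AdeleRing (𝓞 L) L) (conjAdele (Fp L) L (IsCMField.complexConj L))) * klingenLevi (AdeleRing (𝓞 L) L) (conjAdele (Fp L) L (IsCMField.complexConj L)) (conjAdele_conjAdele' L) 1 ((jAdelic L 2).symm (UnitaryGroup.toAdelic (Fp L) L (IsCMField.complexConj L) 2 ((StdForm.antidiagonal 2).over L) bL)) * (weylXi (AdeleRing (𝓞 L) L) (conjAdele (Fp L) L (IsCMField.complexConj L)))⁻¹)) ∈ ratH L e dV hdV dW hdW := by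
  simp only [map_mul, map_inv]
  rw [jAdelic_klingenLevi_one_symm_toAdelic, ← toAdelic_weylXi_eq_jAdelic]
  exact mul_mem (mul_mem (transport_toAdelic_mem_ratH hΨ ha hSA hSAi hXY hYX _) (transport_toAdelic_mem_ratH hΨ ha hSA hSAi hXY hYX _))
    (inv_mem (transport_toAdelic_mem_ratH hΨ ha hSA hSAi hXY hYX _))

/-- at `a = 1` the `Y`-scaling is the identity: `(y ↦ 1⁻¹σ(1⁻¹)·y)_*μ_Y = 1 • μ_Y`. [cite: MoeglinWaldspurger1995, II.1.7] -/
theorem map_scaleY_one_eq (Y : AddSubgroup (AdeleRing (𝓞 L) L)) (hY : ∀ y, y ∈ Y ↔ conjAdele (Fp L) L (IsCMField.complexConj L) y = -y) [MeasurableSpace (AdeleRing (𝓞 L) L)] (μY : Measure ↥Y) :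
    μY.map (fun y : ↥Y => (⟨(((1 : (AdeleRing (𝓞 L) L)ˣ)⁻¹ : (AdeleRing (𝓞 L) L)ˣ) : AdeleRing (𝓞 L) L) * conjAdele (Fp L) L (IsCMField.complexConj L) (((1 : (AdeleRing (𝓞 L) L)ˣ)⁻¹ : (AdeleRing (𝓞 L) L)ˣ) : AdeleRing (𝓞 L) L) * (y : AdeleRing (𝓞 L) L),
        (hY _).2 (skew_unit_mul (conjAdele_conjAdele' L) 1 ((hY _).1 y.2))⟩ : ↥Y)) = (1 : ℝ≥0∞) • μY := by
  have hid : (fun y : ↥Y => (⟨(((1 : (AdeleRing (𝓞 L) L)ˣ)⁻¹ : (AdeleRing (𝓞 L) L)ˣ) : AdeleRing (𝓞 L) L) * conjAdele (Fp L) L (IsCMField.complexConj L) (((1 : (AdeleRing (𝓞 L) L)ˣ)⁻¹ : (AdeleRing (𝓞 L) L)ˣ) : AdeleRing (𝓞 L) L) * (y : AdeleRing (𝓞 L) L),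
        (hY _).2 (skew_unit_mul (conjAdele_conjAdele' L) 1 ((hY _).1 y.2))⟩ : ↥Y)) = id := by
    funext y
    refine Subtype.ext ?_
    simp only [inv_one, Units.val_one, map_one, one_mul, id_eq]
  rw [hid, Measure.map_id, one_smul]

/-- **product formula for the `t`-scaling at a rational `b`**: `(t ↦ 1⁻¹·t·ι(b₀₀))_*μ_T = 1 • μ_T`. [cite: WeilBNT1967, Ch. IV §4 Thm. 5] -/
theorem map_scaleT_principal_eq [MeasurableSpace (AdeleRing (𝓞 L) L)] [BorelSpace (AdeleRing (𝓞 L) L)] (μT : Measure (AdeleRing (𝓞 L) L)) [μT.IsAddHaarMeasure]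
    (bL : unitaryGroupOfForm ((IsCMField.complexConj L : L ≃ₐ[Fp L] L) : L →+* L) ((StdForm.antidiagonal 2).over L)) (hbL : ((bL : GL (Fin 2) L) : Matrix (Fin 2) (Fin 2) L) 1 0 = 0) :
    μT.map (fun t : AdeleRing (𝓞 L) L => (((1 : (AdeleRing (𝓞 L) L)ˣ)⁻¹ : (AdeleRing (𝓞 L) L)ˣ) : AdeleRing (𝓞 L) L) * t *
        (((((jAdelic L 2).symm (UnitaryGroup.toAdelic (Fp L) L (IsCMField.complexConj L) 2 ((StdForm.antidiagonal 2).over L) bL)) : unitaryGroupOfForm (conjAdele (Fp L) L (IsCMField.complexConj L)) ((StdForm.antidiagonal 2).over (AdeleRing (𝓞 L) L))) : GL (Fin 2) (AdeleRing (𝓞 L) L)) : Matrix (Fin 2) (Fin 2) (AdeleRing (𝓞 L) L)) 0 0) =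
      (1 : ℝ≥0∞) • μT := by
  -- `b₀₀^L` is a unit of `L` (upper triangular unitary: `σ(b₁₁) b₀₀ = 1`), its image is a principal idele
  have hrel := upper_rel₂ hbL
  have hu : IsUnit (((bL : GL (Fin 2) L) : Matrix (Fin 2) (Fin 2) L) 0 0) := IsUnit.of_mul_eq_one_right _ hrel
  obtain ⟨u, hu'⟩ := hu
  have h00 : (((((jAdelic L 2).symm (UnitaryGroup.toAdelic (Fp L) L (IsCMField.complexConj L) 2 ((StdForm.antidiagonal 2).over L) bL)) : unitaryGroupOfForm (conjAdele (Fp L) L (IsCMField.complexConj L)) ((StdForm.antidiagonal 2).over (AdeleRing (𝓞 L) L))) : GL (Fin 2) (AdeleRing (𝓞 L) L)) : Matrix (Fin 2) (Fin 2) (AdeleRing (𝓞 L) L)) 0 0 =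
      ((Units.map (algebraMap L (AdeleRing (𝓞 L) L) : L →* AdeleRing (𝓞 L) L) u : (AdeleRing (𝓞 L) L)ˣ) : AdeleRing (𝓞 L) L) := by
    rw [coe_jAdelic_two_symm_toAdelic, Matrix.map_apply, ← hu']; rfl
  have hfun : (fun t : AdeleRing (𝓞 L) L => (((1 : (AdeleRing (𝓞 L) L)ˣ)⁻¹ : (AdeleRing (𝓞 L) L)ˣ) : AdeleRing (𝓞 L) L) * t *
      (((((jAdelic L 2).symm (UnitaryGroup.toAdelic (Fp L) L (IsCMField.complexConj L) 2 ((StdForm.antidiagonal 2).over L) bL)) : unitaryGroupOfForm (conjAdele (Fp L) L (IsCMField.complexConj L)) ((StdForm.antidiagonal 2).over (AdeleRing (𝓞 L) L))) : GL (Fin 2) (AdeleRing (𝓞 L) L)) : Matrix (Fin 2) (Fin 2) (AdeleRing (𝓞 L) L)) 0 0) =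
      fun t => t * ((Units.map (algebraMap L (AdeleRing (𝓞 L) L) : L →* AdeleRing (𝓞 L) L) u : (AdeleRing (𝓞 L) L)ˣ) : AdeleRing (𝓞 L) L) := by
    funext t; rw [h00, inv_one, Units.val_one, one_mul]
  rw [hfun, map_mul_right_eq_self_of_principal μT (units_map_algebraMap_mem_principalIdeles u), one_smul]

/-! ## §2 The inner section of term 2 is left-`B₂(L⁺)`-invariant -/

include hΨ ha hSA hSAi hXY hYX hΨP in
/-- **(Q2) F5-p — E1's `hf` FOR TERM 2.**  `F(x) := ∫ f(Ψ(ξ)·Ψ(n_Q(y,0,t))·x) d(μ_Y × μ_T)` (the inner section after the `u₊`-integration, ★ F5-e), `μ_Y` left invariant and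
`μ_T` a Haar measure on `𝔸_L` (s-finite), `f` a continuous Siegel section; THEN for every RATIONAL upper-triangular `b ∈ U(J₂)(L⁺)` (E1's `borelU`) and `x ∈ H(𝔸)`:
`F(Ψ(toAdelic₄ m_Q(1,b)) · x) = F(x)` — the law ★ F5-c, the substitution ★ F5-n, `D_Y = 1` (`a = 1`), `D_T = 1` (product formula ★ F5-o), and the character `1`
(★ #10a) on the rational element `Ψ(ξ m_Q(1,b) ξ⁻¹)`. [cite: MoeglinWaldspurger1995, II.1.7] [cite: WeilBNT1967, Ch. IV §4 Thm. 5] [cite: Liu2021, §B.3 p. 101] -/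
theorem klingenInner_borelU_mul [MeasurableSpace (AdeleRing (𝓞 L) L)] [BorelSpace (AdeleRing (𝓞 L) L)] [SecondCountableTopology (AdeleRing (𝓞 L) L)]
    (Y : AddSubgroup (AdeleRing (𝓞 L) L)) (hY : ∀ y, y ∈ Y ↔ conjAdele (Fp L) L (IsCMField.complexConj L) y = -y)
    (μY : Measure ↥Y) (μT : Measure (AdeleRing (𝓞 L) L)) [SFinite μY] [SFinite μT] [μY.IsAddLeftInvariant] [μT.IsAddHaarMeasure]
    {χ : HeckeCharacter L} {s : ℂ} {f : HA L e dV hdV dW hdW → ℂ} (hf : IsSiegelDeltaSection L e dV hdV dW hdW χ s f) (hfc : Continuous f)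
    (bL : unitaryGroupOfForm ((IsCMField.complexConj L : L ≃ₐ[Fp L] L) : L →+* L) ((StdForm.antidiagonal 2).over L)) (hbL : bL ∈ borelU ((IsCMField.complexConj L : L ≃ₐ[Fp L] L) : L →+* L) ((StdForm.antidiagonal 2).over L)) (x : HA L e dV hdV dW hdW) :
    (∫ q : ↥Y × AdeleRing (𝓞 L) L, f (Ψ (jAdelic L 4 (weylXi (AdeleRing (𝓞 L) L) (conjAdele (Fp L) L (IsCMField.complexConj L)))) * Ψ (jAdelic L 4 (nKlingen (AdeleRing (𝓞 L) L) (conjAdele (Fp L) L (IsCMField.complexConj L)) (conjAdele_conjAdele' L) (((q.1 : ↥Y) : AdeleRing (𝓞 L) L)) ((hY _).1 q.1.2) 0 (q.2))) * (Ψ (UnitaryGroup.toAdelic (Fp L) L (IsCMField.complexConj L) (2 + 2) ((StdForm.antidiagonal (2 + 2)).over L) (klingenLevi L ((IsCMField.complexConj L : L ≃ₐ[Fp L] L) : L →+* L) (complexConj_ringHom_apply_apply L) 1 bL)) * x)) ∂(μY.prod μT)) = (∫ q : ↥Y × AdeleRing (𝓞 L) L, f (Ψ (jAdelic L 4 (weylXi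 (AdeleRing (𝓞 L) L) (conjAdele (Fp L) L (IsCMField.complexConj L)))) * Ψ (jAdelic L 4 (nKlingen (AdeleRing (𝓞 L) L) (conjAdele (Fp L) L (IsCMField.complexConj L)) (conjAdele_conjAdele' L) (((q.1 : ↥Y) : AdeleRing (𝓞 L) L)) ((hY _).1 q.1.2) 0 (q.2))) * (x)) ∂(μY.prod μT)) := by
  have hb10 : ((bL : GL (Fin 2) L) : Matrix (Fin 2) (Fin 2) L) 1 0 = 0 := (mem_borelU_iff_apply_eq_zero_two _ _).1 hbL
  have hbA : (((((jAdelic L 2).symm (UnitaryGroup.toAdelic (Fp L) L (IsCMField.complexConj L) 2 ((StdForm.antidiagonal 2).over L) bL)) : unitaryGroupOfForm (conjAdele (Fp L) L (IsCMField.complexConj L)) ((StdForm.antidiagonal 2).over (AdeleRing (𝓞 L) L))) : GL (Fin 2) (AdeleRing (𝓞 L) L)) : Matrix (Fin 2) (Fin 2) (AdeleRing (𝓞 L) L)) 1 0 = 0 := by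
    rw [coe_jAdelic_two_symm_toAdelic, Matrix.map_apply, hb10, map_zero]
  rw [← jAdelic_klingenLevi_one_symm_toAdelic]
  have hlaw := klingenInner_levi_law hΨ ha hSA hSAi hΨP (μY.prod μT) (fun q : ↥Y × AdeleRing (𝓞 L) L => ((q.1 : ↥Y) : AdeleRing (𝓞 L) L)) (fun q => (hY _).1 q.1.2)
    (fun q : ↥Y × AdeleRing (𝓞 L) L => q.2) 1 hbA _ (fst_klingenSubst Y hY 1 hbA) (snd_klingenSubst Y hY 1 hbA) hf
    (fun x' => (∫ q : ↥Y × AdeleRing (𝓞 L) L, f (Ψ (jAdelic L 4 (weylXi (AdeleRing (𝓞 L) L) (conjAdele (Fp L) L (IsCMField.complexConj L)))) * Ψ (jAdelic L 4 (nKlingen (AdeleRing (𝓞 L) L) (conjAdele (Fp L) L (IsCMField.complexConj L)) (conjAdele_conjAdele' L) (((q.1 : ↥Y) : AdeleRing (𝓞 L) L)) ((hY _).1 q.1.2) 0 (q.2))) * (x')) ∂(μY.prod μT))) (fun x' => rfl) _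
    (klingenInner_hscale hΨ Y hY μY μT 1 hbA (map_scaleY_one_eq Y hY μY) (map_scaleT_principal_eq μT bL hb10) hfc) x
  rw [hlaw, siegelDeltaCharacter_eq_one_of_mem_ratH χ s (transport_conj_klingenLevi_mem_ratH hΨ ha hSA hSAi hXY hYX bL), one_mul, mul_one,
    ENNReal.toReal_one, Complex.ofReal_one, one_mul]

end Transport

end Summit.HodgeConjecture.HodgeConjecture.Cruxes.HLiu418.K2LiuKlingenInnerSectionBorelInvariant

end
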